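import Mathlib.LinearAlgebra.FiniteDimensional.Lemmas
import Mathlib.LinearAlgebra.Basis.VectorSpace
import Mathlib.LinearAlgebra.Finsupp.Supported
import Mathlib.RingTheory.MvPolynomial.Homogeneous
import Mathlib.Data.Sym.Card
import Mathlib.Data.Finsupp.Multiset
import Literature.NumberTheory.Transcendental.RoySmallValueEstimatesHilbertNumericsProofs
import HarnessLib

/-!
# Small value estimates at rational translates (Nguyen–Roy 2016) — proofs, X: Roy's Lemma 5.1 (regular sequences)

Tenth proofs file towards `Literature.NumberTheory.Transcendental.nguyenRoy2016_thm_1` (Nguyen–Roy,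
IJNT 12 (2016) = arXiv:1412.5163), and the first piece of commutative algebra of the
multiplicity-of-the-resultant layer (Roy, Mathematika 59 (2013) = arXiv:1301.0663 [R2013], §5) on
which §4 of that paper rests. We PROVE **R2013 Lemma 5.1** over an arbitrary field `K`:

* `NguyenRoy.idealUpTo P j = (P₀,…,P_{j−1})`, `NguyenRoy.idealDeg P j ν = (I_j)_ν` (its degree-`ν`
  piece as a `K`-subspace), `NguyenRoy.hilbFun P j ν = dim K[X]_ν − dim (I_j)_ν`;
* `NguyenRoy.idealDeg_succ` — `(I_{j+1})_ν = K[X]_{ν−D}P_j + (I_j)_ν` (`ν ≥ D`), and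
  `NguyenRoy.map_inf_idealDeg_eq` — regularity of `P_j` gives
  `K[X]_{ν−D}P_j ∩ (I_j)_ν = (I_j)_{ν−D}P_j` (the exactness of R2013 (5.1));
* `NguyenRoy.hilbFun_eq_hilbSeq` — hence the recursion (5.3), so `h_j = hilbSeq m D j` (file IX);
* `NguyenRoy.idealDeg_eq_of_regular` — `(P₀,…,P_m)_ν = K[X]_ν` for `ν ≥ (m+1)D − m`;
  `NguyenRoy.hilbFun_eq_pow` — `h_m(ν) = D^m` for `ν ≥ mD − m`;
* `NguyenRoy.existsUnique_decomp`, **`NguyenRoy.exists_decomp_of_regular` = R2013 Lemma 5.1**: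
  for a regular sequence `P₀,…,P_m ∈ K[X₀,…,X_m]_D` and `ν ≥ (m+1)D − m` there are subspaces
  `E_j ⊆ K[X]_{ν−D}` with `dim E_m = D^m` and `K[X]_ν = E₀P₀ ⊕ ⋯ ⊕ E_mP_m` (unique decomposition).

"Regular sequence" is taken in the form used by the source: multiplication by `P_j` is injective on
`K[X]/(P₀,…,P_{j−1})` for each `j` (for `j = 0`: `P₀ ≠ 0`), hypothesis `hreg`. The dimension
`dim K[X₀,…,X_m]_ν = C(ν+m, m)` is recomputed here (`finrank_homogeneousSubmodule_eq_choose`, as in the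
tree's `ProjSpace.finrank_homogeneousSubmodule`, to avoid importing the scheme-theoretic file).
No named facts; the definitions are the objects of the proof, with bodies.

## References

* [Roy2013] D. Roy, *A small value estimate for 𝔾ₐ × 𝔾ₘ*, Mathematika 59 (2013) 333–363 =
  arXiv:1301.0663, §5: Lemma 5.1 and its proof ((5.1)–(5.3)), p. 13 of the arXiv text.
* [NguyenRoy2016] N. A. V. Nguyen, D. Roy, IJNT 12 (2016) = arXiv:1412.5163, §4, Prop. 14 (which
  imports R2013 §5).
-/

noncomputable section

open Polynomial Finset

namespace Literature.NumberTheory.Transcendental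

namespace NguyenRoy

/-! ## R2013 Lemma 5.1: the graded pieces of the ideals of a regular sequence of forms -/

section RegularSeq

variable {K : Type*} [Field K] {σ : Type*}

/-- `I_j = (P₀, …, P_{j−1})`, the ideal generated by the first `j` terms of a sequence of
polynomials (so `I_0 = 0`). [cite: Roy2013, proof of Lemma 5.1] -/
def idealUpTo (P : ℕ → MvPolynomial σ K) (j : ℕ) : Ideal (MvPolynomial σ K) :=
  Ideal.span (Set.range fun i : Fin j => P i)

/-- `(I_j)_ν = I_j ∩ K[X]_ν`, the degree-`ν` piece of `I_j`, as a `K`-subspace of `K[X]`.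
[cite: Roy2013, proof of Lemma 5.1] -/
def idealDeg (P : ℕ → MvPolynomial σ K) (j ν : ℕ) : Submodule K (MvPolynomial σ K) :=
  (idealUpTo P j).restrictScalars K ⊓ MvPolynomial.homogeneousSubmodule σ K ν

/-- Membership in `I_j`: `F = ∑_{i<j} A_i P_i`. [folklore] -/
theorem mem_idealUpTo_iff {P : ℕ → MvPolynomial σ K} {j : ℕ} {F : MvPolynomial σ K} :
    F ∈ idealUpTo P j ↔ ∃ A : Fin j → MvPolynomial σ K, ∑ i, A i * P i = F :=
  Ideal.mem_span_range_iff_exists_fun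

/-- `I_0 = 0`. [folklore] -/
theorem idealUpTo_zero (P : ℕ → MvPolynomial σ K) : idealUpTo P 0 = ⊥ := by
  rw [idealUpTo, Set.range_eq_empty, Ideal.span_empty]

/-- `I_i ⊆ I_j` for `i ≤ j`. [folklore] -/
theorem idealUpTo_mono (P : ℕ → MvPolynomial σ K) {i j : ℕ} (h : i ≤ j) :
    idealUpTo P i ≤ idealUpTo P j := by
  apply Ideal.span_mono
  rintro _ ⟨k, rfl⟩
  exact ⟨⟨k, by omega⟩, rfl⟩

/-- `P_i ∈ I_j` for `i < j`. [folklore] -/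
theorem self_mem_idealUpTo (P : ℕ → MvPolynomial σ K) {i j : ℕ} (h : i < j) :
    P i ∈ idealUpTo P j :=
  Ideal.subset_span ⟨⟨i, h⟩, rfl⟩

/-- Membership in `(I_j)_ν`: `F ∈ I_j` and `F` is a form of degree `ν`. [folklore] -/
theorem mem_idealDeg_iff {P : ℕ → MvPolynomial σ K} {j ν : ℕ} {F : MvPolynomial σ K} :
    F ∈ idealDeg P j ν ↔ F ∈ idealUpTo P j ∧ F.IsHomogeneous ν := by
  simp only [idealDeg, Submodule.mem_inf, Submodule.restrictScalars_mem,
    MvPolynomial.mem_homogeneousSubmodule]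

/-- `(I_j)_ν ⊆ K[X]_ν`. [folklore] -/
theorem idealDeg_le (P : ℕ → MvPolynomial σ K) (j ν : ℕ) :
    idealDeg P j ν ≤ MvPolynomial.homogeneousSubmodule σ K ν := inf_le_right

/-- `(I_i)_ν ⊆ (I_j)_ν` for `i ≤ j`. [folklore] -/
theorem idealDeg_mono (P : ℕ → MvPolynomial σ K) {i j : ℕ} (h : i ≤ j) (ν : ℕ) :
    idealDeg P i ν ≤ idealDeg P j ν := fun _ hF =>
  mem_idealDeg_iff.mpr ⟨idealUpTo_mono P h (mem_idealDeg_iff.mp hF).1, (mem_idealDeg_iff.mp hF).2⟩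

/-- Homogeneous components of a product with a form: `(A·P)_ν = A_{ν−D}·P` for `P ∈ K[X]_D`
(`= 0` if `ν < D`). [folklore] -/
theorem homogeneousComponent_mul_of_isHomogeneous {A P : MvPolynomial σ K} {D : ℕ}
    (hP : P.IsHomogeneous D) (ν : ℕ) :
    MvPolynomial.homogeneousComponent ν (A * P) =
      if D ≤ ν then MvPolynomial.homogeneousComponent (ν - D) A * P else 0 := by
  classical
  conv_lhs => rw [← MvPolynomial.sum_homogeneousComponent A, Finset.sum_mul]
  rw [map_sum]
  have hk : ∀ k, MvPolynomial.homogeneousComponent ν (MvPolynomial.homogeneousComponent k A * P) =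
      if ν = k + D then MvPolynomial.homogeneousComponent k A * P else 0 := fun k =>
    MvPolynomial.homogeneousComponent_of_mem
      ((MvPolynomial.homogeneousComponent_isHomogeneous k A).mul hP)
  simp_rw [hk]
  split_ifs with hD
  · have h1 : ∀ k ∈ range (A.totalDegree + 1),
        (if ν = k + D then MvPolynomial.homogeneousComponent k A * P else 0) =
          if k = ν - D then MvPolynomial.homogeneousComponent k A * P else 0 := by
      intro k _
      by_cases h : k = ν - D
      · rw [if_pos h, if_pos (by omega)]
      · rw [if_neg h, if_neg (by omega)]
    rw [sum_congr rfl h1, sum_ite_eq']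
    split_ifs with h2
    · rfl
    · rw [MvPolynomial.homogeneousComponent_eq_zero, zero_mul]
      rw [mem_range] at h2
      omega
  · exact sum_eq_zero fun k _ => if_neg (by omega)

/-- For `ν < D` the ideals `I_j` (generated by forms of degree `D`) have no degree-`ν` part.
[cite: Roy2013, proof of Lemma 5.1] -/
theorem idealDeg_eq_bot_of_lt {P : ℕ → MvPolynomial σ K} {D : ℕ} (hP : ∀ j, (P j).IsHomogeneous D)
    (j : ℕ) {ν : ℕ} (hν : ν < D) : idealDeg P j ν = ⊥ := by
  rw [eq_bot_iff]
  intro F hF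
  rw [mem_idealDeg_iff, mem_idealUpTo_iff] at hF
  obtain ⟨⟨A, rfl⟩, hF⟩ := hF
  rw [Submodule.mem_bot, ← MvPolynomial.homogeneousComponent_eq_self hF, map_sum]
  refine sum_eq_zero fun i _ => ?_
  rw [homogeneousComponent_mul_of_isHomogeneous (hP i), if_neg (by omega)]

/-- **`(I_{j+1})_ν = K[X]_{ν−D}·P_j + (I_j)_ν`** for `ν ≥ D`. [cite: Roy2013, proof of Lemma 5.1] -/
theorem idealDeg_succ {P : ℕ → MvPolynomial σ K} {D : ℕ} (hP : ∀ j, (P j).IsHomogeneous D)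
    (j : ℕ) {ν : ℕ} (hν : D ≤ ν) :
    idealDeg P (j + 1) ν =
      (MvPolynomial.homogeneousSubmodule σ K (ν - D)).map (LinearMap.mulRight K (P j)) ⊔
        idealDeg P j ν := by
  apply le_antisymm
  · intro F hF
    rw [mem_idealDeg_iff, mem_idealUpTo_iff] at hF
    obtain ⟨⟨A, rfl⟩, hF⟩ := hF
    have key : ∑ i : Fin (j + 1), A i * P i =
        ∑ i : Fin (j + 1), MvPolynomial.homogeneousComponent (ν - D) (A i) * P i := by
      conv_lhs => rw [← MvPolynomial.homogeneousComponent_eq_self hF, map_sum]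
      refine sum_congr rfl fun i _ => ?_
      rw [homogeneousComponent_mul_of_isHomogeneous (hP i), if_pos hν]
    rw [key, Fin.sum_univ_castSucc, add_comm]
    refine Submodule.add_mem_sup ?_ ?_
    · refine ⟨MvPolynomial.homogeneousComponent (ν - D) (A (Fin.last j)),
        MvPolynomial.homogeneousComponent_mem _ _, ?_⟩
      simp only [LinearMap.mulRight_apply, Fin.val_last]
    · rw [mem_idealDeg_iff]
      refine ⟨Ideal.sum_mem _ fun i _ => Ideal.mul_mem_left _ _ ?_,
        MvPolynomial.IsHomogeneous.sum _ _ _ fun i _ => ?_⟩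
      · rw [Fin.val_castSucc]
        exact self_mem_idealUpTo P i.isLt
      · have := (MvPolynomial.homogeneousComponent_isHomogeneous (ν - D) (A (Fin.castSucc i))).mul
          (hP (Fin.castSucc i))
        rwa [Nat.sub_add_cancel hν] at this
  · refine sup_le ?_ (idealDeg_mono P (Nat.le_succ j) ν)
    rintro _ ⟨A, hA, rfl⟩
    rw [SetLike.mem_coe, MvPolynomial.mem_homogeneousSubmodule] at hA
    rw [LinearMap.mulRight_apply, mem_idealDeg_iff]
    refine ⟨Ideal.mul_mem_left _ _ (self_mem_idealUpTo P (Nat.lt_succ_self j)), ?_⟩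
    have := hA.mul (hP j)
    rwa [Nat.sub_add_cancel hν] at this

/-- **Regularity**: if `×P_j` is injective on `K[X]/I_j` then
`K[X]_{ν−D}·P_j ∩ (I_j)_ν = (I_j)_{ν−D}·P_j` (`ν ≥ D`). [cite: Roy2013, proof of Lemma 5.1, (5.1)] -/
theorem map_inf_idealDeg_eq {P : ℕ → MvPolynomial σ K} {D : ℕ} (hP : ∀ j, (P j).IsHomogeneous D)
    (j : ℕ) (hreg : ∀ F, P j * F ∈ idealUpTo P j → F ∈ idealUpTo P j) {ν : ℕ} (hν : D ≤ ν) :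
    (MvPolynomial.homogeneousSubmodule σ K (ν - D)).map (LinearMap.mulRight K (P j)) ⊓
        idealDeg P j ν =
      (idealDeg P j (ν - D)).map (LinearMap.mulRight K (P j)) := by
  apply le_antisymm
  · rintro F ⟨⟨A, hA, rfl⟩, hF⟩
    rw [SetLike.mem_coe, MvPolynomial.mem_homogeneousSubmodule] at hA
    refine ⟨A, ?_, rfl⟩
    rw [SetLike.mem_coe, mem_idealDeg_iff]
    refine ⟨hreg A ?_, hA⟩
    rw [mul_comm]
    exact (mem_idealDeg_iff.mp hF).1
  · rintro _ ⟨A, hA, rfl⟩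
    have hA' := mem_idealDeg_iff.mp hA
    refine ⟨⟨A, hA'.2, rfl⟩, ?_⟩
    rw [SetLike.mem_coe, mem_idealDeg_iff, LinearMap.mulRight_apply]
    refine ⟨Ideal.mul_mem_right _ _ hA'.1, ?_⟩
    have := hA'.2.mul (hP j)
    rwa [Nat.sub_add_cancel hν] at this

/-- A regular member of a sequence of forms of positive degree is nonzero. [folklore] -/
theorem ne_zero_of_regular {P : ℕ → MvPolynomial σ K} {D : ℕ} (hP : ∀ j, (P j).IsHomogeneous D)
    (hD : 1 ≤ D) (j : ℕ) (hreg : ∀ F, P j * F ∈ idealUpTo P j → F ∈ idealUpTo P j) :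
    P j ≠ 0 := by
  intro h0
  have h1 : (1 : MvPolynomial σ K) ∈ idealDeg P j 0 := by
    rw [mem_idealDeg_iff]
    refine ⟨hreg 1 ?_, MvPolynomial.isHomogeneous_one σ K⟩
    rw [h0, zero_mul]
    exact Submodule.zero_mem _
  rw [idealDeg_eq_bot_of_lt hP j (by omega : 0 < D), Submodule.mem_bot] at h1
  exact one_ne_zero h1

/-- `K[X]_ν` is finite-dimensional when there are finitely many variables. [folklore] -/
theorem finiteDimensional_homogeneousSubmodule [Finite σ] (ν : ℕ) :
    FiniteDimensional K (MvPolynomial.homogeneousSubmodule σ K ν) :=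
  Module.Finite.iff_fg.2 (MvPolynomial.homogeneousSubmodule_fg σ K ν)

attribute [local instance] finiteDimensional_homogeneousSubmodule

/-- `K[X]_{ν−D}·P ⊆ K[X]_ν` for a form `P` of degree `D ≤ ν`. [folklore] -/
theorem map_mulRight_le {P : MvPolynomial σ K} {D : ℕ} (hP : P.IsHomogeneous D) {ν : ℕ} (hν : D ≤ ν) :
    (MvPolynomial.homogeneousSubmodule σ K (ν - D)).map (LinearMap.mulRight K P) ≤
      MvPolynomial.homogeneousSubmodule σ K ν := by
  rintro _ ⟨A, hA, rfl⟩
  rw [SetLike.mem_coe, MvPolynomial.mem_homogeneousSubmodule] at hA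
  rw [MvPolynomial.mem_homogeneousSubmodule, LinearMap.mulRight_apply]
  have := hA.mul hP
  rwa [Nat.sub_add_cancel hν] at this

variable {m : ℕ}

/-- The Hilbert function `h_j(ν) = dim_K K[X₀,…,X_m]_ν − dim_K (I_j)_ν = dim_K (K[X]/I_j)_ν`
(`= dim E_j(ν)` in Roy's notation). [cite: Roy2013, proof of Lemma 5.1] -/
def hilbFun (P : ℕ → MvPolynomial (Fin (m + 1)) K) (j ν : ℕ) : ℤ :=
  (Module.finrank K (MvPolynomial.homogeneousSubmodule (Fin (m + 1)) K ν) : ℤ) -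
    Module.finrank K (idealDeg P j ν)

/-- `dim_K K[X₀,…,X_m]_ν = C(ν+m, m)`: the monomials of degree `ν` form a basis
(`MvPolynomial.homogeneousSubmodule_eq_finsupp_supported`) and correspond to `Sym (Fin (m+1)) ν`
(`Sym.equivNatSum`, `Sym.card_sym_eq_multichoose`). The same computation as the tree's
`ProjSpace.finrank_homogeneousSubmodule` (Literature/AlgebraicGeometry/Motives/ProjectiveSpaceSections),
redone here in a few lines to keep this algebra file free of the scheme-theoretic import closure.
[folklore] -/
theorem finrank_homogeneousSubmodule_eq_choose (ν : ℕ) :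
    Module.finrank K (MvPolynomial.homogeneousSubmodule (Fin (m + 1)) K ν) = (ν + m).choose m := by
  classical
  have e1 : (MvPolynomial.homogeneousSubmodule (Fin (m + 1)) K ν :
      Submodule K (MvPolynomial (Fin (m + 1)) K)) =
      AddMonoidAlgebra.supported K K {v : Fin (m + 1) →₀ ℕ | v.degree = ν} :=
    MvPolynomial.homogeneousSubmodule_eq_finsupp_supported (Fin (m + 1)) K ν
  let e : MvPolynomial.homogeneousSubmodule (Fin (m + 1)) K ν ≃ₗ[K]
      ({v : Fin (m + 1) →₀ ℕ // v.degree = ν} →₀ K) :=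
    (LinearEquiv.ofEq _ _ e1).trans (AddMonoidAlgebra.supportedEquivFinsupp _)
  -- monomials of degree `ν` ↔ multisets of size `ν`
  let f : {v : Fin (m + 1) →₀ ℕ // v.degree = ν} ≃ Sym (Fin (m + 1)) ν :=
    (Equiv.subtypeEquivRight fun v => by rw [Finsupp.degree_apply]; exact Iff.rfl).trans
      (Sym.equivNatSum _ ν).symm
  letI : Fintype {v : Fin (m + 1) →₀ ℕ // v.degree = ν} := Fintype.ofEquiv _ f.symm
  rw [e.finrank_eq, (Finsupp.linearEquivFunOnFinite K K _).finrank_eq,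
    Module.finrank_fintype_fun_eq_card, ← Nat.card_eq_fintype_card, Nat.card_congr f,
    Nat.card_eq_fintype_card, Sym.card_sym_eq_multichoose, Fintype.card_fin, Nat.multichoose_eq,
    show m + 1 + ν - 1 = ν + m by omega, Nat.choose_symm_add]

/-- **The Hilbert function of a regular sequence of forms of degree `D`** satisfies Roy's recursion:
`h_j(ν) = hilbSeq m D j ν` for all `j ≤ k` as long as `P₀, …, P_{k−1}` is a regular sequence, i.e.
`h_0(ν) = C(ν+m, m)` and `h_{j+1}(ν) = h_j(ν) − h_j(ν−D)` (from the exact sequence (5.1)).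
[cite: Roy2013, proof of Lemma 5.1, (5.1) and (5.3)] -/
theorem hilbFun_eq_hilbSeq {P : ℕ → MvPolynomial (Fin (m + 1)) K} {D : ℕ} (hD : 1 ≤ D)
    (hP : ∀ j, (P j).IsHomogeneous D) {k : ℕ}
    (hreg : ∀ j < k, ∀ F, P j * F ∈ idealUpTo P j → F ∈ idealUpTo P j) :
    ∀ j ≤ k, ∀ ν : ℕ, hilbFun P j ν = hilbSeq m D j ν := by
  intro j hj
  induction j with
  | zero =>
    intro ν
    have h0 : idealDeg P 0 ν = ⊥ := by
      rw [idealDeg, idealUpTo_zero]; simp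
    rw [hilbFun, h0, finrank_bot, finrank_homogeneousSubmodule_eq_choose, hilbSeq_zero_of_nonneg]
    simp
  | succ j ih =>
    intro ν
    have ih' := ih (by omega)
    have hregj := hreg j (by omega)
    by_cases hν : ν < D
    · rw [hilbSeq_succ_of_lt m D j (by exact_mod_cast hν), ← ih' ν, hilbFun, hilbFun,
        idealDeg_eq_bot_of_lt hP (j + 1) hν, idealDeg_eq_bot_of_lt hP j hν]
    · rw [not_lt] at hν
      set U := (MvPolynomial.homogeneousSubmodule (Fin (m + 1)) K (ν - D)).map
        (LinearMap.mulRight K (P j)) with hU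
      haveI : FiniteDimensional K (idealDeg P j ν) :=
        Submodule.finiteDimensional_of_le (idealDeg_le P j ν)
      haveI : FiniteDimensional K (idealDeg P j (ν - D)) :=
        Submodule.finiteDimensional_of_le (idealDeg_le P j (ν - D))
      have hG := Submodule.finrank_sup_add_finrank_inf_eq U (idealDeg P j ν)
      rw [hU, ← idealDeg_succ hP j hν, map_inf_idealDeg_eq hP j hregj hν] at hG
      have hinj : Function.Injective (LinearMap.mulRight K (P j)) :=
        mul_left_injective₀ (ne_zero_of_regular hP hD j hregj)
      rw [← (Submodule.equivMapOfInjective _ hinj (idealDeg P j (ν - D))).finrank_eq,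
        ← (Submodule.equivMapOfInjective _ hinj
          (MvPolynomial.homogeneousSubmodule (Fin (m + 1)) K (ν - D))).finrank_eq] at hG
      have hcast : (ν : ℤ) - (D : ℤ) = ((ν - D : ℕ) : ℤ) := by push_cast [Nat.cast_sub hν]; ring
      rw [hilbSeq_succ, ← ih' ν, hcast, ← ih' (ν - D)]
      unfold hilbFun
      have hG' : (Module.finrank K (idealDeg P (j + 1) ν) : ℤ) + Module.finrank K (idealDeg P j (ν - D)) =
          Module.finrank K (MvPolynomial.homogeneousSubmodule (Fin (m + 1)) K (ν - D)) +
            Module.finrank K (idealDeg P j ν) := by exact_mod_cast hG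
      linarith

/-- **`(P₀,…,P_m)_ν = K[X]_ν` for `ν ≥ (m+1)D − m`** when `P₀,…,P_m ∈ K[X₀,…,X_m]_D` is a regular
sequence (`E_{m+1}(ν) = 0`). [cite: Roy2013, Lemma 5.1 (proof)] -/
theorem idealDeg_eq_of_regular {P : ℕ → MvPolynomial (Fin (m + 1)) K} {D : ℕ} (hD : 1 ≤ D)
    (hP : ∀ j, (P j).IsHomogeneous D)
    (hreg : ∀ j ≤ m, ∀ F, P j * F ∈ idealUpTo P j → F ∈ idealUpTo P j) {ν : ℕ}
    (hν : (m + 1) * D ≤ ν + m) :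
    idealDeg P (m + 1) ν = MvPolynomial.homogeneousSubmodule (Fin (m + 1)) K ν := by
  have h := hilbFun_eq_hilbSeq hD hP (k := m + 1) (fun j hj => hreg j (by omega)) (m + 1) le_rfl ν
  rw [hilbSeq_succ_self m D ν (by have h' := hν; zify at h'; linarith)] at h
  haveI : FiniteDimensional K (idealDeg P (m + 1) ν) :=
    Submodule.finiteDimensional_of_le (idealDeg_le P (m + 1) ν)
  refine Submodule.eq_of_le_of_finrank_eq (idealDeg_le P (m + 1) ν) ?_
  unfold hilbFun at h
  omega

/-- **`h_m(ν) = D^m` for `ν ≥ mD − m`** (`dim E_m(ν) = D^m`). [cite: Roy2013, Lemma 5.1 (proof)] -/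
theorem hilbFun_eq_pow {P : ℕ → MvPolynomial (Fin (m + 1)) K} {D : ℕ} (hD : 1 ≤ D)
    (hP : ∀ j, (P j).IsHomogeneous D)
    (hreg : ∀ j < m, ∀ F, P j * F ∈ idealUpTo P j → F ∈ idealUpTo P j) {ν : ℕ}
    (hν : m * D ≤ ν + m) :
    hilbFun P m ν = (D : ℤ) ^ m := by
  rw [hilbFun_eq_hilbSeq hD hP hreg m le_rfl ν]
  exact hilbSeq_self m D ν (by have h' := hν; zify at h'; linarith)

/-! ### Complements and the direct sum decomposition (5.2) -/

/-- A complement of `V` inside `W ⊇ V`. [folklore] -/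
theorem exists_compl_le {M : Type*} [AddCommGroup M] [Module K M] (V W : Submodule K M)
    (hVW : V ≤ W) : ∃ E : Submodule K M, E ≤ W ∧ V ⊓ E = ⊥ ∧ V ⊔ E = W := by
  obtain ⟨q, hq⟩ := (V.comap W.subtype).exists_isCompl
  refine ⟨q.map W.subtype, Submodule.map_subtype_le W q, ?_, ?_⟩
  · rw [eq_bot_iff]
    rintro x ⟨hxV, ⟨y, hy, rfl⟩⟩
    have : y ∈ V.comap W.subtype ⊓ q := ⟨hxV, hy⟩
    rw [hq.inf_eq_bot, Submodule.mem_bot] at this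
    rw [this, map_zero]
    exact Submodule.zero_mem _
  · apply le_antisymm (sup_le hVW (Submodule.map_subtype_le W q))
    intro w hw
    have : (⟨w, hw⟩ : W) ∈ V.comap W.subtype ⊔ q := by rw [hq.sup_eq_top]; trivial
    obtain ⟨a, ha, b, hb, hab⟩ := Submodule.mem_sup.mp this
    rw [Submodule.mem_sup]
    refine ⟨(a : M), ha, (b : M), ⟨b, hb, rfl⟩, ?_⟩
    have := congrArg Subtype.val hab
    simpa using this

/-- **Unique decomposition** `F = ∑_{i<k} Q_i P_i`, `Q_i ∈ E_i`, for `F ∈ (I_k)_ν`, when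
`P₀, …, P_{k−1}` is regular and `E_i` is a complement of `(I_i)_{ν−D}` in `K[X]_{ν−D}`:
`(I_k)_ν = ⊕_{i<k} E_i·P_i`. [cite: Roy2013, proof of Lemma 5.1, (5.2)] -/
theorem existsUnique_decomp {P : ℕ → MvPolynomial σ K} {D : ℕ} (hD : 1 ≤ D)
    (hP : ∀ j, (P j).IsHomogeneous D) {ν : ℕ} (hν : D ≤ ν)
    (E : ℕ → Submodule K (MvPolynomial σ K))
    (hE : ∀ j, idealDeg P j (ν - D) ⊓ E j = ⊥ ∧
      idealDeg P j (ν - D) ⊔ E j = MvPolynomial.homogeneousSubmodule σ K (ν - D))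
    {k : ℕ} (hreg : ∀ j < k, ∀ F, P j * F ∈ idealUpTo P j → F ∈ idealUpTo P j)
    {F : MvPolynomial σ K} (hF : F ∈ idealDeg P k ν) :
    ∃! Q : Fin k → MvPolynomial σ K, (∀ i : Fin k, Q i ∈ E i) ∧ ∑ i, Q i * P i = F := by
  have hEle : ∀ j, E j ≤ MvPolynomial.homogeneousSubmodule σ K (ν - D) := fun j => by
    rw [← (hE j).2]; exact le_sup_right
  -- the sum of a family with `Q i ∈ E i` restricted to the first `k` indices lies in `(I_k)_ν`
  have hsum_mem : ∀ (k : ℕ) (Q : Fin k → MvPolynomial σ K), (∀ i : Fin k, Q i ∈ E i) →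
      ∑ i, Q i * P i ∈ idealDeg P k ν := by
    intro k Q hQ
    rw [mem_idealDeg_iff]
    refine ⟨Ideal.sum_mem _ fun i _ => Ideal.mul_mem_left _ _ (self_mem_idealUpTo P i.isLt),
      MvPolynomial.IsHomogeneous.sum _ _ _ fun i _ => ?_⟩
    have h1 : (Q i).IsHomogeneous (ν - D) := hEle i (hQ i)
    have := h1.mul (hP i)
    rwa [Nat.sub_add_cancel hν] at this
  induction k generalizing F with
  | zero =>
    refine ⟨fun i => i.elim0, ⟨fun i => i.elim0, ?_⟩, fun Q _ => funext fun i => i.elim0⟩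
    rw [idealDeg, idealUpTo_zero, Submodule.restrictScalars_bot, bot_inf_eq, Submodule.mem_bot] at hF
    simp [hF]
  | succ k ih =>
    have hregk := hreg k (Nat.lt_succ_self k)
    have ih' := fun {F} (hF : F ∈ idealDeg P k ν) => ih (fun j hj => hreg j (by omega)) hF
    -- pairwise uniqueness at level `k + 1`
    have huniq : ∀ Q₁ Q₂ : Fin (k + 1) → MvPolynomial σ K,
        ((∀ i : Fin (k + 1), Q₁ i ∈ E i) ∧ ∑ i, Q₁ i * P i = F) →
        ((∀ i : Fin (k + 1), Q₂ i ∈ E i) ∧ ∑ i, Q₂ i * P i = F) → Q₁ = Q₂ := by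
      rintro Q₁ Q₂ ⟨h₁, e₁⟩ ⟨h₂, e₂⟩
      rw [Fin.sum_univ_castSucc] at e₁ e₂
      simp only [Fin.val_castSucc, Fin.val_last] at e₁ e₂
      set S₁ := ∑ i : Fin k, Q₁ (Fin.castSucc i) * P i with hS₁
      set S₂ := ∑ i : Fin k, Q₂ (Fin.castSucc i) * P i with hS₂
      have hS₁mem : S₁ ∈ idealDeg P k ν :=
        hsum_mem k (fun i => Q₁ (Fin.castSucc i)) fun i => h₁ (Fin.castSucc i)
      have hS₂mem : S₂ ∈ idealDeg P k ν :=
        hsum_mem k (fun i => Q₂ (Fin.castSucc i)) fun i => h₂ (Fin.castSucc i)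
      -- the last coefficients agree
      have hlast : Q₁ (Fin.last k) = Q₂ (Fin.last k) := by
        have hdiff : (Q₁ (Fin.last k) - Q₂ (Fin.last k)) * P k ∈
            (MvPolynomial.homogeneousSubmodule σ K (ν - D)).map (LinearMap.mulRight K (P k)) ⊓
              idealDeg P k ν := by
          refine ⟨⟨Q₁ (Fin.last k) - Q₂ (Fin.last k),
            Submodule.sub_mem _ (hEle k (h₁ (Fin.last k))) (hEle k (h₂ (Fin.last k))), rfl⟩, ?_⟩
          have : (Q₁ (Fin.last k) - Q₂ (Fin.last k)) * P k = S₂ - S₁ := by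
            rw [sub_mul]; linear_combination e₁ - e₂
          rw [SetLike.mem_coe, this]
          exact Submodule.sub_mem _ hS₂mem hS₁mem
        rw [map_inf_idealDeg_eq hP k hregk hν] at hdiff
        obtain ⟨w, hw, hw'⟩ := hdiff
        rw [LinearMap.mulRight_apply] at hw'
        have hw'' : w = Q₁ (Fin.last k) - Q₂ (Fin.last k) :=
          mul_left_injective₀ (ne_zero_of_regular hP hD k hregk) hw'
        have hmem : Q₁ (Fin.last k) - Q₂ (Fin.last k) ∈ idealDeg P k (ν - D) ⊓ E k :=
          ⟨hw'' ▸ hw, Submodule.sub_mem _ (h₁ (Fin.last k)) (h₂ (Fin.last k))⟩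
        rw [(hE k).1, Submodule.mem_bot, sub_eq_zero] at hmem
        exact hmem
      -- hence the initial segments decompose the same element of `(I_k)_ν`
      have hS : S₁ = S₂ := by
        have := e₁.trans e₂.symm
        rw [hlast] at this
        exact add_right_cancel this
      have hinit : (fun i : Fin k => Q₁ (Fin.castSucc i)) = fun i => Q₂ (Fin.castSucc i) :=
        (ih' hS₁mem).unique ⟨fun i => h₁ (Fin.castSucc i), rfl⟩
          ⟨fun i => h₂ (Fin.castSucc i), by rw [← hS₂, ← hS]⟩
      funext i
      induction i using Fin.lastCases with
      | last => exact hlast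
      | cast i => exact congrFun hinit i
    -- existence at level `k + 1`
    rw [idealDeg_succ hP k hν, Submodule.mem_sup] at hF
    obtain ⟨u, ⟨A, hA, rfl⟩, g, hg, hF⟩ := hF
    rw [SetLike.mem_coe, ← (hE k).2, Submodule.mem_sup] at hA
    obtain ⟨v, hv, e, he, rfl⟩ := hA
    have hG' : v * P k + g ∈ idealDeg P k ν := by
      refine Submodule.add_mem _ ?_ hg
      rw [mem_idealDeg_iff]
      have hv' := mem_idealDeg_iff.mp hv
      refine ⟨Ideal.mul_mem_right _ _ hv'.1, ?_⟩
      have := hv'.2.mul (hP k)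
      rwa [Nat.sub_add_cancel hν] at this
    obtain ⟨Q', ⟨hQ'E, hQ'sum⟩, -⟩ := ih' hG'
    refine ⟨Fin.snoc Q' e, ⟨?_, ?_⟩, fun Q₁ hQ₁ => huniq Q₁ _ hQ₁ ⟨?_, ?_⟩⟩
    · intro i
      induction i using Fin.lastCases with
      | last => simpa using he
      | cast i => simpa using hQ'E i
    · rw [Fin.sum_univ_castSucc]
      simp only [Fin.snoc_castSucc, Fin.snoc_last, Fin.val_castSucc, Fin.val_last, hQ'sum]
      rw [← hF, LinearMap.mulRight_apply]
      ring
    · intro i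
      induction i using Fin.lastCases with
      | last => simpa using he
      | cast i => simpa using hQ'E i
    · rw [Fin.sum_univ_castSucc]
      simp only [Fin.snoc_castSucc, Fin.snoc_last, Fin.val_castSucc, Fin.val_last, hQ'sum]
      rw [← hF, LinearMap.mulRight_apply]
      ring

/-- **Roy 2013, Lemma 5.1.** Let `P₀, …, P_m ∈ K[X₀,…,X_m]_D` (`D ≥ 1`) be a regular sequence
(multiplication by `P_j` injective modulo `(P₀,…,P_{j−1})` for `j = 0,…,m`) and
`ν ≥ (m+1)D − m`. Then there are subspaces `E₀, …, E_m ⊆ K[X]_{ν−D}` with `dim E_m = D^m` and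
`K[X]_ν = E₀P₀ ⊕ ⋯ ⊕ E_mP_m` (every `F ∈ K[X]_ν` is uniquely `∑ Q_j P_j` with `Q_j ∈ E_j`).
Stated over any field `K` (the source has `K = ℂ`). [cite: Roy2013, Lemma 5.1] -/
theorem exists_decomp_of_regular {D : ℕ} (hD : 1 ≤ D) (P : ℕ → MvPolynomial (Fin (m + 1)) K)
    (hP : ∀ j, (P j).IsHomogeneous D)
    (hreg : ∀ j ≤ m, ∀ F, P j * F ∈ idealUpTo P j → F ∈ idealUpTo P j) {ν : ℕ}
    (hν : (m + 1) * D ≤ ν + m) :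
    ∃ E : Fin (m + 1) → Submodule K (MvPolynomial (Fin (m + 1)) K),
      (∀ j, E j ≤ MvPolynomial.homogeneousSubmodule (Fin (m + 1)) K (ν - D)) ∧
      Module.finrank K (E (Fin.last m)) = D ^ m ∧
      ∀ F ∈ MvPolynomial.homogeneousSubmodule (Fin (m + 1)) K ν,
        ∃! Q : Fin (m + 1) → MvPolynomial (Fin (m + 1)) K,
          (∀ j : Fin (m + 1), Q j ∈ E j) ∧ ∑ j, Q j * P j = F := by
  have hDν : D ≤ ν := by
    have : m ≤ m * D := Nat.le_mul_of_pos_right m hD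
    nlinarith
  choose E hE using fun j : ℕ => exists_compl_le (K := K) (idealDeg P j (ν - D))
    (MvPolynomial.homogeneousSubmodule (Fin (m + 1)) K (ν - D)) (idealDeg_le P j (ν - D))
  refine ⟨fun j => E j, fun j => (hE j).1, ?_, ?_⟩
  · -- `dim E_m = h_m(ν − D) = D^m`
    haveI : FiniteDimensional K (idealDeg P m (ν - D)) :=
      Submodule.finiteDimensional_of_le (idealDeg_le P m (ν - D))
    haveI : FiniteDimensional K (E m) := Submodule.finiteDimensional_of_le (hE m).1
    have hG := Submodule.finrank_sup_add_finrank_inf_eq (idealDeg P m (ν - D)) (E m)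
    rw [(hE m).2.1, (hE m).2.2, finrank_bot, add_zero] at hG
    have h := hilbFun_eq_pow hD hP (fun j hj => hreg j hj.le) (ν := ν - D)
      (by zify [hDν] at hν ⊢; linarith)
    unfold hilbFun at h
    simp only [Fin.val_last]
    have : (Module.finrank K (E m) : ℤ) = (D : ℤ) ^ m := by push_cast [hG] at h ⊢; linarith
    exact_mod_cast this
  · intro F hF
    have hF' : F ∈ idealDeg P (m + 1) ν := by rwa [idealDeg_eq_of_regular hD hP hreg hν]
    exact existsUnique_decomp hD hP hDν E (fun j => (hE j).2) (k := m + 1)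
      (fun j hj => hreg j (by omega)) hF'

end RegularSeq

end NguyenRoy

end Literature.NumberTheory.Transcendental
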